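import Literature.MathematicalPhysics.QuantumFieldTheory.Balaban1983to89.B1Eq324BenfattoSect5StructuralErrors
import HarnessLib

/-!
# `Balaban1983to89.B1Eq324BenfattoSect5StructuralErrorsUpper` — [BenfattoEtAl1978] §5 p. 159 «Collecting all the errors»: the structural
# error ledger of the UPPER ((4.6)) chain, whose steps carry (5.11) at the INPUT cut-off `γb_k` and (5.34) at the OUTPUT cut-off `b_k` —
# PROVED for the tree's objects (sequel of `…Sect5StructuralErrors`, same currency)

statement-level skeleton of published theorems with citation tags; proofs where landed; nothing here is a claim about the
Yang–Mills mass gap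

WHY THIS MODULE (cell `pub-ymgap`, seat `dag-n08-d` gen 10, INTENT-42; node N08 [Balaban1985UV3]; the [BenfattoEtAl1978] source chain behind the
(α)-row `h324c`).  `…Sect5StructuralErrors.sum_structuralErr_le` bounds the structural errors of the LOWER chain
(`…Sect5PavementChain.lowerPavementChain`), where both error terms of step `k` sit at the same cut-off `b_k`.  The UPPER chain
(`…Sect5PavementChainUpper.upperPavementChainCond`, seat `dag-n08-c`) displays `s₁A(γb_k)^De^{−(ϰ/4)w}|J_k| + s₁Ab_k^D(e^{−(ϰ/4)w}|Γ̄₁(B_k)| +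
e^{−(ϰ/4)v}|B_k|L^d)` — (5.11) at the step's input cut-off `γb_k`, (5.34) at its output cut-off `b_k` — so the single-cut-off lemma does not match it
literally.  This file gives the two-cut-off step bound and the sum in that exact currency.  (A separate module rather than a v1.1 append of
`…Sect5StructuralErrors`: append-only re-submission of that file is blocked by a later twin of its `admissible_eq_empty_of_lt` in `…Sect5ErrTermLedger`.)

WHAT IS PROVED (standard axioms; no `sorry`; no definition).
* §1 `structuralErr_le₂` (one step, (5.11) at cut-off `b'`, (5.34) at cut-off `b`, both in `[0, b̂]`: `≤ |I|·3s₁Ab̂^DL^de^{−(ϰ/4)v}`),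
  ★★ `sum_structuralErr_upper_le` (the sum over `n` steps with `b' = γb_k`, `0 ≤ γ ≤ 1`: `≤ n·|I|·3s₁Ab̂^DL^de^{−(ϰ/4)v}`; `b̂ = b_n` by
  `…Sect5StructuralErrors.rec_div_le`).
HONEST SCOPE.  Bookkeeping inequalities between displayed real numbers; the identification losses, the terminal term and the absorption into `errTerm`
are not here; count-neutral for N08; `BasicLemmaPrinted` NOT discharged; nothing about d = 4, the continuum, OS axioms, a mass gap or the Clay problem.
-/

noncomputable section

open Finset
open scoped BigOperators

namespace Literature.MathematicalPhysics.QuantumFieldTheory.Balaban1983to89.B1Eq324BenfattoSect5StructuralErrorsUpper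

open Literature.MathematicalPhysics.QuantumFieldTheory.Balaban1983to89.B1Eq324BenfattoLemma
open Literature.MathematicalPhysics.QuantumFieldTheory.Balaban1983to89.B1Eq324BenfattoSect5Boxes
open Literature.MathematicalPhysics.QuantumFieldTheory.Balaban1983to89.B1Eq324BenfattoSect5Eq511
open Literature.MathematicalPhysics.QuantumFieldTheory.Balaban1983to89.B1Eq324BenfattoSect5Eq534
open Literature.MathematicalPhysics.QuantumFieldTheory.Balaban1983to89.B1Eq324BenfattoSect5StructuralErrors

variable {d : ℕ}

/-! ## §1  The upper chain's mixed thresholds: `err₅₁₁` at the INPUT cut-off `γb_k`, `err₅₃₄` at the OUTPUT cut-off `b_k` -/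

section Upper

variable {s D : ℕ} {κ A : ℝ} {L w v : ℕ}

/-- **One step, two cut-offs**: the same bound as `structuralErr_le` when (5.11) is taken at a cut-off `b'` and (5.34) at a cut-off `b`, both in
`[0, b̂]` — the shape of `…Sect5PavementChainUpper.upperPavementChainCond`'s exponent (`b' = γ·b_k`, `b = b_k`).
[cite: BenfattoEtAl1978, (5.11) p.155, (5.34)–(5.36) p.159] -/
theorem structuralErr_le₂ (hκ : 0 < κ) (hA0 : 0 ≤ A) (hv : v ≤ w) (hL : 1 ≤ L)
    {J B : Finset (B1Eq324BenfattoLemma.Site d)} {nI : ℕ} (hJ : J.card ≤ nI) (hB : B.card ≤ J.card)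
    {b b' bhat : ℝ} (hb0 : 0 ≤ b) (hb : b ≤ bhat) (hb0' : 0 ≤ b') (hb' : b' ≤ bhat) :
    s1Const s D d κ * A * b' ^ D * Real.exp (-(κ / 4 * w)) * J.card
        + s1Const s D d κ * A * b ^ D *
          (Real.exp (-(κ / 4 * w)) * (corridorsBar L w v B).card + Real.exp (-(κ / 4 * v)) * (B.card * (L : ℝ) ^ d))
      ≤ nI * (3 * (s1Const s D d κ * A * bhat ^ D * (L : ℝ) ^ d * Real.exp (-(κ / 4 * v)))) := by
  -- the first summand is monotone in its cut-off: replace `b'` by `b̂`, the other two by `structuralErr_le` at `(b, b̂)` with `J`-term dropped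
  have hs1 : 0 ≤ s1Const s D d κ := s1Const_nonneg hκ s D d
  have hLd : (1 : ℝ) ≤ (L : ℝ) ^ d := one_le_pow₀ (by exact_mod_cast hL)
  have hLd0 : (0 : ℝ) ≤ (L : ℝ) ^ d := zero_le_one.trans hLd
  have hev0 : 0 ≤ Real.exp (-(κ / 4 * v)) := (Real.exp_pos _).le
  have hew0 : 0 ≤ Real.exp (-(κ / 4 * w)) := (Real.exp_pos _).le
  have hwv : Real.exp (-(κ / 4 * w)) ≤ Real.exp (-(κ / 4 * v)) := by
    rw [Real.exp_le_exp]
    have : (v : ℝ) ≤ w := by exact_mod_cast hv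
    nlinarith
  have hJI : (J.card : ℝ) ≤ nI := by exact_mod_cast hJ
  have hBI : (B.card : ℝ) ≤ nI := by exact_mod_cast hB.trans hJ
  have hΓ : ((corridorsBar L w v B).card : ℝ) ≤ nI * (L : ℝ) ^ d := by
    have h' : ((corridorsBar L w v B).card : ℝ) ≤ B.card * (L : ℝ) ^ d := by
      exact_mod_cast B1Eq324BenfattoSect5Eq534.card_corridorsBar_le L w v B (d := d)
    exact h'.trans (mul_le_mul_of_nonneg_right hBI hLd0)
  set chat : ℝ := s1Const s D d κ * A * bhat ^ D with hchat
  have hc' : s1Const s D d κ * A * b' ^ D ≤ chat := mul_le_mul_of_nonneg_left (pow_le_pow_left₀ hb0' hb' D) (mul_nonneg hs1 hA0)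
  have hc : s1Const s D d κ * A * b ^ D ≤ chat := mul_le_mul_of_nonneg_left (pow_le_pow_left₀ hb0 hb D) (mul_nonneg hs1 hA0)
  have hc0' : 0 ≤ s1Const s D d κ * A * b' ^ D := mul_nonneg (mul_nonneg hs1 hA0) (pow_nonneg hb0' D)
  have hc0 : 0 ≤ s1Const s D d κ * A * b ^ D := mul_nonneg (mul_nonneg hs1 hA0) (pow_nonneg hb0 D)
  have hchat0 : 0 ≤ chat := hc0.trans hc
  have hce : 0 ≤ chat * Real.exp (-(κ / 4 * v)) := mul_nonneg hchat0 hev0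
  have h1 : s1Const s D d κ * A * b' ^ D * Real.exp (-(κ / 4 * w)) * J.card ≤ nI * (chat * (L : ℝ) ^ d * Real.exp (-(κ / 4 * v))) := by
    calc s1Const s D d κ * A * b' ^ D * Real.exp (-(κ / 4 * w)) * J.card ≤ chat * Real.exp (-(κ / 4 * v)) * nI := by gcongr
      _ ≤ chat * (L : ℝ) ^ d * Real.exp (-(κ / 4 * v)) * nI := by
          have : chat * Real.exp (-(κ / 4 * v)) ≤ chat * (L : ℝ) ^ d * Real.exp (-(κ / 4 * v)) := by
            nlinarith [mul_nonneg hce (sub_nonneg.mpr hLd)]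
          exact mul_le_mul_of_nonneg_right this (Nat.cast_nonneg _)
      _ = nI * (chat * (L : ℝ) ^ d * Real.exp (-(κ / 4 * v))) := by ring
  have h2 : s1Const s D d κ * A * b ^ D * (Real.exp (-(κ / 4 * w)) * (corridorsBar L w v B).card)
      ≤ nI * (chat * (L : ℝ) ^ d * Real.exp (-(κ / 4 * v))) := by
    calc s1Const s D d κ * A * b ^ D * (Real.exp (-(κ / 4 * w)) * (corridorsBar L w v B).card)
        ≤ chat * (Real.exp (-(κ / 4 * v)) * (nI * (L : ℝ) ^ d)) := by gcongr
      _ = nI * (chat * (L : ℝ) ^ d * Real.exp (-(κ / 4 * v))) := by ring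
  have h3 : s1Const s D d κ * A * b ^ D * (Real.exp (-(κ / 4 * v)) * (B.card * (L : ℝ) ^ d))
      ≤ nI * (chat * (L : ℝ) ^ d * Real.exp (-(κ / 4 * v))) := by
    calc s1Const s D d κ * A * b ^ D * (Real.exp (-(κ / 4 * v)) * (B.card * (L : ℝ) ^ d))
        ≤ chat * (Real.exp (-(κ / 4 * v)) * (nI * (L : ℝ) ^ d)) := by gcongr
      _ = nI * (chat * (L : ℝ) ^ d * Real.exp (-(κ / 4 * v))) := by ring
  have hsplit : s1Const s D d κ * A * b' ^ D * Real.exp (-(κ / 4 * w)) * J.card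
      + s1Const s D d κ * A * b ^ D *
        (Real.exp (-(κ / 4 * w)) * (corridorsBar L w v B).card + Real.exp (-(κ / 4 * v)) * (B.card * (L : ℝ) ^ d))
      = s1Const s D d κ * A * b' ^ D * Real.exp (-(κ / 4 * w)) * J.card
        + s1Const s D d κ * A * b ^ D * (Real.exp (-(κ / 4 * w)) * (corridorsBar L w v B).card)
        + s1Const s D d κ * A * b ^ D * (Real.exp (-(κ / 4 * v)) * (B.card * (L : ℝ) ^ d)) := by ring
  rw [hsplit]
  calc _ ≤ nI * (chat * (L : ℝ) ^ d * Real.exp (-(κ / 4 * v))) + nI * (chat * (L : ℝ) ^ d * Real.exp (-(κ / 4 * v)))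
        + nI * (chat * (L : ℝ) ^ d * Real.exp (-(κ / 4 * v))) := add_le_add (add_le_add h1 h2) h3
    _ = nI * (3 * (chat * (L : ℝ) ^ d * Real.exp (-(κ / 4 * v)))) := by ring
    _ = nI * (3 * (s1Const s D d κ * A * bhat ^ D * (L : ℝ) ^ d * Real.exp (-(κ / 4 * v)))) := by rw [hchat]

/-- **THE STRUCTURAL ERROR LEDGER OF THE UPPER CHAIN** — in the literal currency of `…Sect5PavementChainUpper.upperPavementChainCond` /
`ineq46_of_chain`: the exponent's structural part reads `s₁A(γb_k)^De^{−(ϰ/4)w}|J_k| + s₁Ab_k^D(e^{−(ϰ/4)w}|Γ̄₁(B_k)| + e^{−(ϰ/4)v}|B_k|L^d)` ((5.11) at the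
step's INPUT cut-off `γb_k`, (5.34) at its OUTPUT cut-off `b_k`); with `0 ≤ γ ≤ 1`, `|J_k| ≤ |I|`, `|B_k| ≤ |J_k|`, `0 ≤ b_k ≤ b̂` its sum over `n` steps is
`≤ n·|I|·3·s₁·A·b̂^D·L^d·e^{−(ϰ/4)v}` (`b̂ = b_n` by `rec_div_le`). [cite: BenfattoEtAl1978, §5 (5.36) p.159, (4.6) p.152] -/
theorem sum_structuralErr_upper_le (hκ : 0 < κ) (hA0 : 0 ≤ A) (hv : v ≤ w) (hL : 1 ≤ L) {γ : ℝ} (hγ0 : 0 ≤ γ) (hγ : γ ≤ 1) {n nI : ℕ}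
    {Js Bs : ℕ → Finset (B1Eq324BenfattoLemma.Site d)} {bs : ℕ → ℝ} {bhat : ℝ}
    (hJ : ∀ k < n, (Js k).card ≤ nI) (hB : ∀ k < n, (Bs k).card ≤ (Js k).card) (hb0 : ∀ k < n, 0 ≤ bs k) (hb : ∀ k < n, bs k ≤ bhat) :
    ∑ k ∈ Finset.range n,
        (s1Const s D d κ * A * (γ * bs k) ^ D * Real.exp (-(κ / 4 * w)) * (Js k).card
          + s1Const s D d κ * A * bs k ^ D *
            (Real.exp (-(κ / 4 * w)) * (corridorsBar L w v (Bs k)).card + Real.exp (-(κ / 4 * v)) * ((Bs k).card * (L : ℝ) ^ d)))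
      ≤ n * (nI * (3 * (s1Const s D d κ * A * bhat ^ D * (L : ℝ) ^ d * Real.exp (-(κ / 4 * v))))) := by
  calc _ ≤ ∑ _k ∈ Finset.range n, (nI : ℝ) * (3 * (s1Const s D d κ * A * bhat ^ D * (L : ℝ) ^ d * Real.exp (-(κ / 4 * v)))) :=
        Finset.sum_le_sum fun k hk => by
          have hk' := Finset.mem_range.mp hk
          have hγb0 : 0 ≤ γ * bs k := mul_nonneg hγ0 (hb0 k hk')
          have hγb : γ * bs k ≤ bhat := (mul_le_of_le_one_left (hb0 k hk') hγ).trans (hb k hk')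
          exact structuralErr_le₂ hκ hA0 hv hL (hJ k hk') (hB k hk') (hb0 k hk') (hb k hk') hγb0 hγb
    _ = _ := by rw [Finset.sum_const, Finset.card_range, nsmul_eq_mul]

end Upper

end Literature.MathematicalPhysics.QuantumFieldTheory.Balaban1983to89.B1Eq324BenfattoSect5StructuralErrorsUpper

end
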